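import Summits.Ventures.HodgeRepro2.T5SU11LegendreIdentities

/-!
# `|P_n(x)| ≤ 1` on `[−1, 1]`: the Legendre polynomials are bounded by their value at `1`

Sturm's argument from Legendre's equation: for `n ≥ 1` the function
`F_n(x) := P_n(x)² + (1 − x²) P_n'(x)²/(n(n + 1))` has derivative `F_n'(x) = 2x P_n'(x)²/(n(n + 1))`
(`hasDerivAt_sturm`), so it is monotone on `[0, 1]` and antitone on `[−1, 0]` and is maximal at `x = ±1`, where it
equals `P_n(±1)² = 1`. Hence **`(1 − x²) P_n'(x)² ≤ n(n + 1)(1 − P_n(x)²)`** and **`|P_n(x)| ≤ 1`** on `[−1, 1]`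
(`sturm_le_one`, `abs_legP_le_one`, `sq_legP_le_one`), with `P_n(1) = 1` attained. Together with
`T5SU11SphericalLegendreAll.one_le_legP` (`P_n ≥ 1` on `[1, ∞)`, read off the group) this locates the range of
`P_n` on the two sides of `x = 1`: the spherical functions `φ_{2n+2}(a_t) = P_n(cosh 2t)` live on `[1, ∞)`, the
compact-dual values `P_n(cos θ)` on `[−1, 1]`. Nothing is claimed about (N).

Blind lane: Mathlib + the HodgeRepro2 prefix only; no sorry; axioms ⊆ {propext, Classical.choice,
Quot.sound}.
-/

namespace Summit.Ventures.HodgeRepro2.T5SU11LegendreBound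

open MeasureTheory Metric Set Filter Topology Finset
open T5SU11SphericalLegendreAll T5SU11SphericalLegendreLaplace T5SU11LegendreIdentities

/-- **Sturm's function** `F_n(x) = P_n(x)² + (1 − x²) P_n'(x)²/(n(n + 1))`. -/
noncomputable def sturm (n : ℕ) (x : ℝ) : ℝ := legP n x ^ 2 + (1 - x ^ 2) * legQ n x ^ 2 / ((n : ℝ) * (n + 1))

/-- **`F_n'(x) = 2x P_n'(x)²/(n(n + 1))`** for `n ≥ 1`, by Legendre's equation. -/
theorem hasDerivAt_sturm {n : ℕ} (hn : 1 ≤ n) (x : ℝ) :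
    HasDerivAt (sturm n) (2 * x * legQ n x ^ 2 / ((n : ℝ) * (n + 1))) x := by
  have hn' : (n : ℝ) * (n + 1) ≠ 0 := by
    have : (1 : ℝ) ≤ n := by exact_mod_cast hn
    positivity
  have h1 := (hasDerivAt_legP n x).pow 2
  have h2 := (((hasDerivAt_const x (1 : ℝ)).sub (hasDerivAt_pow 2 x)).mul ((hasDerivAt_legQ n x).pow 2)).div_const
    ((n : ℝ) * (n + 1))
  have h := h1.add h2
  refine (h.congr_deriv ?_).congr_of_eventuallyEq (Filter.Eventually.of_forall fun y => ?_)
  · have hode := legendre_ode n x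
    simp only [Pi.sub_apply]
    norm_num
    field_simp
    linear_combination (-(legQ n x)) * hode
  · simp only [sturm, Pi.add_apply, Pi.sub_apply, Pi.mul_apply, Pi.pow_apply]

/-- `F_n` is continuous. -/
theorem continuous_sturm {n : ℕ} (hn : 1 ≤ n) : Continuous (sturm n) :=
  continuous_iff_continuousAt.mpr fun x => (hasDerivAt_sturm hn x).continuousAt

/-- `F_n(1) = 1`. -/
theorem sturm_one (n : ℕ) : sturm n 1 = 1 := by
  simp [sturm, legP_one]

/-- `F_n(−1) = 1`. -/
theorem sturm_neg_one (n : ℕ) : sturm n (-1) = 1 := by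
  simp [sturm, legP_neg_one, ← pow_mul]

/-- `F_n` is monotone on `[0, 1]`. -/
theorem monotoneOn_sturm_Icc {n : ℕ} (hn : 1 ≤ n) : MonotoneOn (sturm n) (Icc 0 1) := by
  refine monotoneOn_of_deriv_nonneg (convex_Icc 0 1) (continuous_sturm hn).continuousOn
    (fun x _ => (hasDerivAt_sturm hn x).differentiableAt.differentiableWithinAt) fun x hx => ?_
  rw [(hasDerivAt_sturm hn x).deriv]
  rw [interior_Icc] at hx
  have : (0 : ℝ) ≤ x := (mem_Ioo.mp hx).1.le
  positivity

/-- `F_n` is antitone on `[−1, 0]`. -/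
theorem antitoneOn_sturm_Icc {n : ℕ} (hn : 1 ≤ n) : AntitoneOn (sturm n) (Icc (-1) 0) := by
  refine antitoneOn_of_deriv_nonpos (convex_Icc (-1) 0) (continuous_sturm hn).continuousOn
    (fun x _ => (hasDerivAt_sturm hn x).differentiableAt.differentiableWithinAt) fun x hx => ?_
  rw [(hasDerivAt_sturm hn x).deriv]
  rw [interior_Icc] at hx
  have hx0 : x ≤ 0 := (mem_Ioo.mp hx).2.le
  have hpos : 0 < (n : ℝ) * (n + 1) := by
    have : (1 : ℝ) ≤ n := by exact_mod_cast hn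
    positivity
  apply div_nonpos_of_nonpos_of_nonneg _ hpos.le
  have := sq_nonneg (legQ n x)
  nlinarith

/-- **`F_n(x) ≤ 1` on `[−1, 1]`.** -/
theorem sturm_le_one {n : ℕ} (hn : 1 ≤ n) {x : ℝ} (hx : x ∈ Icc (-1 : ℝ) 1) : sturm n x ≤ 1 := by
  rcases le_or_gt 0 x with h0 | h0
  · have := monotoneOn_sturm_Icc hn (mem_Icc.mpr ⟨h0, hx.2⟩) (mem_Icc.mpr ⟨zero_le_one, le_rfl⟩) hx.2
    rwa [sturm_one] at this
  · have := antitoneOn_sturm_Icc hn (mem_Icc.mpr ⟨le_rfl, by norm_num⟩) (mem_Icc.mpr ⟨hx.1, h0.le⟩) hx.1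
    rwa [sturm_neg_one] at this

/-- **`(1 − x²) P_n'(x)² ≤ n(n + 1)(1 − P_n(x)²)`** on `[−1, 1]`. -/
theorem one_sub_sq_mul_legQ_sq_le {n : ℕ} (hn : 1 ≤ n) {x : ℝ} (hx : x ∈ Icc (-1 : ℝ) 1) :
    (1 - x ^ 2) * legQ n x ^ 2 ≤ (n : ℝ) * (n + 1) * (1 - legP n x ^ 2) := by
  have h := sturm_le_one hn hx
  have hpos : 0 < (n : ℝ) * (n + 1) := by
    have : (1 : ℝ) ≤ n := by exact_mod_cast hn
    positivity
  unfold sturm at h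
  rw [← sub_nonneg]
  have : (n : ℝ) * (n + 1) * (1 - legP n x ^ 2) - (1 - x ^ 2) * legQ n x ^ 2
      = (n : ℝ) * (n + 1) * (1 - (legP n x ^ 2 + (1 - x ^ 2) * legQ n x ^ 2 / ((n : ℝ) * (n + 1)))) := by
    field_simp
    ring
  rw [this]
  exact mul_nonneg hpos.le (by linarith)

/-- **`P_n(x)² ≤ 1` on `[−1, 1]`.** -/
theorem sq_legP_le_one (n : ℕ) {x : ℝ} (hx : x ∈ Icc (-1 : ℝ) 1) : legP n x ^ 2 ≤ 1 := by
  rcases Nat.eq_zero_or_pos n with rfl | hn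
  · simp
  · have h := sturm_le_one hn hx
    unfold sturm at h
    have hpos : 0 < (n : ℝ) * (n + 1) := by
      have : (1 : ℝ) ≤ n := by exact_mod_cast hn
      positivity
    have h1 : 0 ≤ (1 - x ^ 2) * legQ n x ^ 2 / ((n : ℝ) * (n + 1)) := by
      have : 0 ≤ 1 - x ^ 2 := by nlinarith [hx.1, hx.2]
      positivity
    linarith

/-- **`|P_n(x)| ≤ 1` on `[−1, 1]`**, with equality at `x = 1`. -/
theorem abs_legP_le_one (n : ℕ) {x : ℝ} (hx : x ∈ Icc (-1 : ℝ) 1) : |legP n x| ≤ 1 := by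
  rw [← sq_le_one_iff_abs_le_one]
  exact sq_legP_le_one n hx

/-- The two-sided form `−1 ≤ P_n(x) ≤ 1` on `[−1, 1]`. -/
theorem legP_mem_Icc (n : ℕ) {x : ℝ} (hx : x ∈ Icc (-1 : ℝ) 1) : legP n x ∈ Icc (-1 : ℝ) 1 :=
  abs_le.mp (abs_legP_le_one n hx)

/-- The supremum of `|P_n|` on `[−1, 1]` is attained at `x = 1`: `|P_n(x)| ≤ P_n(1)`. -/
theorem abs_legP_le_legP_one (n : ℕ) {x : ℝ} (hx : x ∈ Icc (-1 : ℝ) 1) : |legP n x| ≤ legP n 1 := by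
  rw [legP_one]
  exact abs_legP_le_one n hx

end Summit.Ventures.HodgeRepro2.T5SU11LegendreBound
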